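import Summits.CriticalPhenomena.Ising3DConformalLimit.Theorems.EnergyNotSigmaSquaredGapForcesFarMergingScreeningIdentity
import Summits.CriticalPhenomena.Ising3DConformalLimit.Theorems.EnergyNotSigmaSquaredGapForcesFarMergingFloorsReduction
import Literature.Probability.LatticeModels.WeightedClusterDecomposition

/-! # The two-strand form of the screening ladder (ADC21 Lemma A.1 at EVERY exploration radius)
(line `screening-form-lemma-a1` of crux `GapForcesFarMerging`, item stmt-CriticalPhenomena-4468; helper of `stub_floors`)

`stub_screeningIdentity` reads the FULL-radius mean screening as a two-current avoidance probability. Here every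
rung is read: Lemma A.1 (`Current.tsum_epairWeight_eq_tsum_mul_offRatio`) applied to `F = 𝟙[a,b ∉ C]·S_{ab}(C_r)/S_{ab}(C)`
— local in the second current off the duplicated cluster `C = C(o)`, since the explored cluster `C_r(o)` is read on the
open bonds INSIDE `C` — gives, for `o, x, a, b ∈ Λ_n` and every `r` (`sw_r = screenWeight n r o a b`, real `x/0 = 0`),
  `meanScreening n r o x a b = ∫ sw_r/sw_n dP^{{o}∆{x},{a}∆{b}}_{Λ_n} + ∫ 𝟙{sw_n = 0}·sw_r dP^{{o}∆{x},∅}_{Λ_n}`.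
Under `P^{ox}⊗P^{ab}` the second current joins `a` to `b`, so `sw_n > 0` exactly on the AVOIDANCE event `{o ↮ a}` and
the first integral is `E[𝟙{o ↮ a}·S(C_r)/S(C)]`; the second (sealed pocket: `C` disconnects `a` from `b` in `Λ_n ∖ C`
without swallowing them, `C_r` does not) vanishes at `r = n`. So the bulk floor `δ·A(2^k;m) ≤ A(n;m)` reads
`E^{0up⊗e₂dn}[𝟙{0↮e₂}·S(C_{2^k})/S(C)] + N(2^k;m) ≤ δ⁻¹·P[0 ↮ e₂]`: a statement about the avoidance-conditioned PAIR
of strands at aspect ratio `m/2^k ∈ [8,16)` — the separation lemma in two-strand clothing.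
References: Aizenman–Duminil-Copin 2021 (arXiv:1912.07973), Appendix A, Lemma A.1; Lawler 1991 ch. 3. -/

noncomputable section

namespace Summit.CriticalPhenomena.Ising3DConformalLimit.EnergyNotSigmaSquaredGapForcesFarMerging

open scoped symmDiff ENNReal
open MeasureTheory Filter Finset
open Literature.Probability.LatticeModels Literature.Probability.Percolation
open Summit.CriticalPhenomena.Ising3DConformalLimit.Theorems.GapForcesFarMerging.Negative (e₁ e₂ cc2 xR up dn)
open Summit.CriticalPhenomena.Ising3DConformalLimit.GapForcesFarMergingScreening

/-! ### Locality of the explored cluster in the second current -/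

/-- An edge at a vertex of `C = C_{n₁+n₂}(o)` is traced by `n₁ + n₂'` iff by `n₁ + n₂`, when `n₂'` agrees with
`n₂` on the edges meeting `C`. [folklore] -/
theorem twoStrand_traced_congr {n : ℕ} {n₁ n₂ n₂' : Current (freeBoxGraph 3 n)} {o : BoxVertex 3 n}
    (h : ∀ e : (freeBoxGraph 3 n).edgeFinset,
      ¬ Current.EdgeOff ((n₁ + n₂).cluster o) (e : Sym2 (BoxVertex 3 n)) → n₂' e = n₂ e)
    {u w : BoxVertex 3 n} (hu : u ∈ (n₁ + n₂).cluster o) :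
    s(u, w) ∈ (n₁ + n₂').traced ↔ s(u, w) ∈ (n₁ + n₂).traced := by
  have hno : ∀ hG : s(u, w) ∈ (freeBoxGraph 3 n).edgeFinset,
      ¬ Current.EdgeOff ((n₁ + n₂).cluster o)
        ((⟨s(u, w), hG⟩ : (freeBoxGraph 3 n).edgeFinset) : Sym2 (BoxVertex 3 n)) :=
    fun hG ho => (Current.edgeOff_mk.1 ho).1 hu
  simp only [Current.traced, Set.mem_setOf_eq, Pi.add_apply]
  constructor
  · rintro ⟨hG, hpos⟩
    exact ⟨hG, by rw [← h _ (hno hG)]; exact hpos⟩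
  · rintro ⟨hG, hpos⟩
    exact ⟨hG, by rw [h _ (hno hG)]; exact hpos⟩

/-- Membership of a bond of `ℤ³` with an endpoint in `Λ_{n+1}` in a lifted configuration. [folklore] -/
theorem twoStrand_mem_liftBonds_iff {n : ℕ} (ω : BondConfig (BoxVertex 3 n)) {u w : Site 3}
    (hu : u ∈ box 3 (n + 1)) :
    s(u, w) ∈ liftBonds 3 n ω ↔ ∃ hw : w ∈ box 3 (n + 1), s((⟨u, hu⟩ : BoxVertex 3 n), ⟨w, hw⟩) ∈ ω := by
  constructor
  · rintro ⟨e', he', he'eq⟩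
    have hw : w ∈ box 3 (n + 1) := by
      have : w ∈ Sym2.map Subtype.val e' := by rw [he'eq]; exact Sym2.mem_mk_right u w
      obtain ⟨c, -, rfl⟩ := Sym2.mem_map.1 this
      exact c.2
    refine ⟨hw, ?_⟩
    have : e' = s((⟨u, hu⟩ : BoxVertex 3 n), ⟨w, hw⟩) := by
      apply Sym2.map.injective Subtype.val_injective
      rw [he'eq, Sym2.map_mk]
    rw [← this]
    exact he'
  · rintro ⟨hw, he⟩
    exact ⟨_, he, by simp⟩

/-- Adjacency in the open graph of the lifted trace at a vertex of the duplicated cluster is unchanged when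
the second current is modified off the cluster. [folklore] -/
theorem twoStrand_adj_congr {n : ℕ} {n₁ n₂ n₂' : Current (freeBoxGraph 3 n)} {o : BoxVertex 3 n}
    (h : ∀ e : (freeBoxGraph 3 n).edgeFinset,
      ¬ Current.EdgeOff ((n₁ + n₂).cluster o) (e : Sym2 (BoxVertex 3 n)) → n₂' e = n₂ e)
    {u : Site 3} (hu : u ∈ box 3 (n + 1)) (huC : (⟨u, hu⟩ : BoxVertex 3 n) ∈ (n₁ + n₂).cluster o)
    (w : Site 3) :
    (openGraph (sourcedTrace 3 n (n₁, n₂'))).Adj u w ↔ (openGraph (sourcedTrace 3 n (n₁, n₂))).Adj u w := by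
  simp only [openGraph_adj, sourcedTrace, twoStrand_mem_liftBonds_iff _ hu, twoStrand_traced_congr h huC]

/-- An open bond of the lifted trace from a vertex of the duplicated cluster leads into the cluster. [folklore] -/
theorem twoStrand_cluster_step {n : ℕ} {m : Current (freeBoxGraph 3 n)} {o : BoxVertex 3 n}
    {u : Site 3} (hu : u ∈ box 3 (n + 1)) (huC : (⟨u, hu⟩ : BoxVertex 3 n) ∈ m.cluster o) {w : Site 3}
    (hadj : (openGraph (liftBonds 3 n m.traced)).Adj u w) :
    ∃ hw : w ∈ box 3 (n + 1), (⟨w, hw⟩ : BoxVertex 3 n) ∈ m.cluster o := by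
  rw [openGraph_adj, twoStrand_mem_liftBonds_iff _ hu] at hadj
  obtain ⟨⟨hw, he⟩, hne⟩ := hadj
  refine ⟨hw, Current.mem_cluster_of_adj huC ?_⟩
  rw [openGraph_adj]
  exact ⟨he, fun heq => hne (congrArg Subtype.val heq)⟩

/-- **Locality of the explored cluster**: the cluster of `o` explored with steps of ANY step graph `K` on the
lifted trace is unchanged when the second current is modified off `C_{n₁+n₂}(o)`. [folklore] -/
theorem twoStrand_openClusterIn_congr {n : ℕ} {n₁ n₂ n₂' : Current (freeBoxGraph 3 n)} {o : BoxVertex 3 n}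
    (h : ∀ e : (freeBoxGraph 3 n).edgeFinset,
      ¬ Current.EdgeOff ((n₁ + n₂).cluster o) (e : Sym2 (BoxVertex 3 n)) → n₂' e = n₂ e)
    (K : SimpleGraph (Site 3)) :
    openClusterIn K (sourcedTrace 3 n (n₁, n₂')) (o : Site 3) = openClusterIn K (sourcedTrace 3 n (n₁, n₂)) o := by
  -- the invariant: being (the image of) a vertex of the duplicated cluster
  have hP₀ : ∃ ho : (o : Site 3) ∈ box 3 (n + 1), (⟨o, ho⟩ : BoxVertex 3 n) ∈ (n₁ + n₂).cluster o :=
    ⟨o.2, by simp⟩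
  have hin : ∀ u w : Site 3, (∃ hu : u ∈ box 3 (n + 1), (⟨u, hu⟩ : BoxVertex 3 n) ∈ (n₁ + n₂).cluster o) →
      (openGraph (sourcedTrace 3 n (n₁, n₂))).Adj u w →
      ∃ hw : w ∈ box 3 (n + 1), (⟨w, hw⟩ : BoxVertex 3 n) ∈ (n₁ + n₂).cluster o :=
    fun u w ⟨hu, huC⟩ hadj => twoStrand_cluster_step hu huC hadj
  ext v
  rw [mem_openClusterIn_iff, mem_openClusterIn_iff]
  constructor
  · intro hv
    refine Current.reachable_transfer
      (P := fun u => ∃ hu : u ∈ box 3 (n + 1), (⟨u, hu⟩ : BoxVertex 3 n) ∈ (n₁ + n₂).cluster o)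
      (fun u w hu hadj => ?_) hP₀ hv
    obtain ⟨hu', huC⟩ := hu
    rw [SimpleGraph.inf_adj] at hadj ⊢
    have h1 := (twoStrand_adj_congr h hu' huC w).1 hadj.1
    exact ⟨⟨h1, hadj.2⟩, hin u w ⟨hu', huC⟩ h1⟩
  · intro hv
    refine Current.reachable_transfer
      (P := fun u => ∃ hu : u ∈ box 3 (n + 1), (⟨u, hu⟩ : BoxVertex 3 n) ∈ (n₁ + n₂).cluster o)
      (fun u w hu hadj => ?_) hP₀ hv
    obtain ⟨hu', huC⟩ := hu
    rw [SimpleGraph.inf_adj] at hadj ⊢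
    exact ⟨⟨(twoStrand_adj_congr h hu' huC w).2 hadj.1, hadj.2⟩, hin u w ⟨hu', huC⟩ hadj.1⟩

/-- **Locality of the screening functional at every radius**: `screenWeight n r o a b` on the lifted trace of
`(n₁, n₂)` is unchanged when `n₂` is modified off `C_{n₁+n₂}(o)` (the `hloc` hypothesis of Lemma A.1).
[cite: AizenmanDuminilCopinAnnals2021, Appendix A, Lemma A.1] -/
theorem twoStrand_screenWeight_congr {n : ℕ} (r : ℕ) {n₁ n₂ n₂' : Current (freeBoxGraph 3 n)}
    {o : BoxVertex 3 n} (a b : BoxVertex 3 n)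
    (h : ∀ e : (freeBoxGraph 3 n).edgeFinset,
      ¬ Current.EdgeOff ((n₁ + n₂).cluster o) (e : Sym2 (BoxVertex 3 n)) → n₂' e = n₂ e) :
    screenWeight n r o a b (sourcedTrace 3 n (n₁, n₂')) = screenWeight n r o a b (sourcedTrace 3 n (n₁, n₂)) := by
  have hC : (n₁ + n₂').cluster o = (n₁ + n₂).cluster o := Current.cluster_add_congr_right h
  have hmem : ∀ z : BoxVertex 3 n, (z : Site 3) ∈ openCluster (sourcedTrace 3 n (n₁, n₂')) (o : Site 3) ↔
      (z : Site 3) ∈ openCluster (sourcedTrace 3 n (n₁, n₂)) (o : Site 3) := fun z => by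
    rw [coe_mem_openCluster_sourcedTrace_iff, coe_mem_openCluster_sourcedTrace_iff]
    show z ∈ (n₁ + n₂').cluster o ↔ z ∈ (n₁ + n₂).cluster o
    rw [hC]
  have hI : innerCluster r (o : Site 3) (sourcedTrace 3 n (n₁, n₂')) =
      innerCluster r (o : Site 3) (sourcedTrace 3 n (n₁, n₂)) := by
    unfold innerCluster
    rw [twoStrand_openClusterIn_congr h]
  unfold screenWeight
  rw [hI]
  by_cases hc : (a : Site 3) ∈ openCluster (sourcedTrace 3 n (n₁, n₂)) (o : Site 3) ∨
      (b : Site 3) ∈ openCluster (sourcedTrace 3 n (n₁, n₂)) (o : Site 3)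
  · rw [if_pos hc, if_pos ((or_congr (hmem a) (hmem b)).2 hc)]
  · rw [if_neg hc, if_neg fun h' => hc ((or_congr (hmem a) (hmem b)).1 h')]

/-! ### The two-strand identity -/

/-- `ℝ≥0∞` bookkeeping behind the identity: with `ofReal s_n = q·z₀/z_B` (all normalisers finite and
nonzero), `e·(ofReal(s_r/s_n)·q)·(z_A z_B)⁻¹ = e·(z_A z₀)⁻¹·ofReal s_r`. [folklore] -/
theorem twoStrand_algebra {e q zA zB z0 : ℝ≥0∞} {sr sn : ℝ} (he : e ≠ ∞) (hq0 : q ≠ 0) (hq : q ≠ ∞)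
    (hA0 : zA ≠ 0) (hA : zA ≠ ∞) (hB0 : zB ≠ 0) (hB : zB ≠ ∞) (h00 : z0 ≠ 0) (h0 : z0 ≠ ∞)
    (hsr : 0 ≤ sr) (hsn : ENNReal.ofReal sn = q * z0 / zB) (hsn0 : 0 < sn) :
    e * (ENNReal.ofReal (sr / sn) * q) * (zA * zB)⁻¹ = e * (zA * z0)⁻¹ * ENNReal.ofReal sr := by
  have hsnR : sn = (q * z0 / zB).toReal := by rw [← hsn, ENNReal.toReal_ofReal hsn0.le]
  have hqR : 0 < q.toReal := ENNReal.toReal_pos hq0 hq; have hAR : 0 < zA.toReal := ENNReal.toReal_pos hA0 hA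
  have hBR : 0 < zB.toReal := ENNReal.toReal_pos hB0 hB; have h0R : 0 < z0.toReal := ENNReal.toReal_pos h00 h0
  have hL : e * (ENNReal.ofReal (sr / sn) * q) * (zA * zB)⁻¹ ≠ ∞ :=
    ENNReal.mul_ne_top (ENNReal.mul_ne_top he (ENNReal.mul_ne_top ENNReal.ofReal_ne_top hq))
      (ENNReal.inv_ne_top.2 (mul_ne_zero hA0 hB0))
  have hR : e * (zA * z0)⁻¹ * ENNReal.ofReal sr ≠ ∞ :=
    ENNReal.mul_ne_top (ENNReal.mul_ne_top he (ENNReal.inv_ne_top.2 (mul_ne_zero hA0 h00))) ENNReal.ofReal_ne_top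
  rw [← ENNReal.toReal_eq_toReal_iff' hL hR]
  simp only [ENNReal.toReal_mul, ENNReal.toReal_inv, ENNReal.toReal_ofReal hsr,
    ENNReal.toReal_ofReal (div_nonneg hsr hsn0.le)]
  rw [hsnR, ENNReal.toReal_div, ENNReal.toReal_mul]
  field_simp

/-- **Integrals against a box law as `ℝ≥0∞` series**: for `f ≥ 0` and nondegenerate normalisers,
`∫ f dP^{A,B}_{Λ_n} = (∑_p w_{A,B}(p)·(Z[A]Z[B])⁻¹·ofReal (f (trace p))).toReal`. [cite: AizenmanDuminilCopinAnnals2021, §3.1] -/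
theorem twoStrand_integral_eq_toReal_tsum (n : ℕ) {A B : Finset (BoxVertex 3 n)} {A₀ B₀ : Finset (Site 3)}
    (hA : boxSources 3 n A₀ = A) (hB : boxSources 3 n B₀ = B)
    (hcA : currentSum (freeBoxGraph 3 n) (criticalBeta 3) A ≠ 0)
    (hcB : currentSum (freeBoxGraph 3 n) (criticalBeta 3) B ≠ 0) (f : BondConfig (Site 3) → ℝ)
    (hf : ∀ ω, 0 ≤ f ω) :
    ∫ ω, f ω ∂(sourcedDoubleCurrentLaw 3 n (criticalBeta 3) A₀ B₀) =
      (∑' p : Current (freeBoxGraph 3 n) × Current (freeBoxGraph 3 n),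
        epairWeight (fun _ : (freeBoxGraph 3 n).edgeFinset => criticalBeta 3) A B p *
          (ecurrentSum (fun _ : (freeBoxGraph 3 n).edgeFinset => criticalBeta 3) A *
            ecurrentSum (fun _ : (freeBoxGraph 3 n).edgeFinset => criticalBeta 3) B)⁻¹ *
          ENNReal.ofReal (f (sourcedTrace 3 n p))).toReal := by
  set K : (freeBoxGraph 3 n).edgeFinset → ℝ := fun _ => criticalBeta 3 with hKc
  have hβ : 0 ≤ criticalBeta 3 := criticalBeta_nonneg 3
  have hK : ∀ e : (freeBoxGraph 3 n).edgeFinset, 0 ≤ K e := fun _ => hβ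
  have hZne : ∀ S : Finset (BoxVertex 3 n), currentSum (freeBoxGraph 3 n) (criticalBeta 3) S ≠ 0 →
      ecurrentSum K S ≠ 0 := fun S hS h =>
    hS (by rw [currentSum_eq_wcurrentSum, ← hKc, ← toReal_ecurrentSum hK, h, ENNReal.toReal_zero])
  have hfin : ∀ p : Current (freeBoxGraph 3 n) × Current (freeBoxGraph 3 n),
      epairWeight K A B p * (ecurrentSum K A * ecurrentSum K B)⁻¹ * ENNReal.ofReal (f (sourcedTrace 3 n p)) ≠ ∞ :=
    fun p => ENNReal.mul_ne_top (ENNReal.mul_ne_top (epairWeight_ne_top _ _ _ p)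
      (ENNReal.inv_ne_top.2 (mul_ne_zero (hZne _ hcA) (hZne _ hcB)))) ENNReal.ofReal_ne_top
  rw [integral_sourcedDoubleCurrentLaw n hβ, hA, hB, ENNReal.tsum_toReal_eq hfin]
  refine tsum_congr fun p => ?_
  rw [pairWeight_div_eq_toReal _ hβ hcA hcB, ENNReal.toReal_mul, ENNReal.toReal_mul, ENNReal.toReal_ofReal (hf _),
    ENNReal.toReal_div, ENNReal.toReal_mul, ENNReal.toReal_inv, ENNReal.toReal_mul, div_eq_mul_inv]

/-- `sw_n ≠ 0` on the lifted trace forces `a, b ∉ C_{n₁+n₂}(o)`. [folklore] -/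
theorem twoStrand_not_mem_cluster {n : ℕ} {o a b : BoxVertex 3 n}
    (p : Current (freeBoxGraph 3 n) × Current (freeBoxGraph 3 n))
    (hp : screenWeight n n o a b (sourcedTrace 3 n p) ≠ 0) :
    ¬ (a ∈ (p.1 + p.2).cluster o ∨ b ∈ (p.1 + p.2).cluster o) := fun hab => by
  apply hp
  unfold screenWeight
  rw [if_pos]
  rwa [coe_mem_openCluster_sourcedTrace_iff, coe_mem_openCluster_sourcedTrace_iff]

/-- **The pointwise key of the two-strand identity**:
`w_{A,∅}(p)·(ofReal(sw_r/sw_n)·Z_{G∖C}[B]/Z_{G∖C}[∅])·(Z[A]Z[B])⁻¹ = w_{A,∅}(p)·(Z[A]Z[∅])⁻¹·ofReal(𝟙{sw_n ≠ 0}·sw_r)`,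
by the full-radius dictionary `ofReal sw_n = 𝟙·(Z_{G∖C}[B]/Z_{G∖C}[∅])·Z[∅]/Z[B]`. [cite: AizenmanDuminilCopinAnnals2021, Appendix A, Lemma A.1] -/
theorem twoStrand_key (n r : ℕ) {o x a b : BoxVertex 3 n} (ho : (o : Site 3) ∈ box 3 n)
    (hx : (x : Site 3) ∈ box 3 n) (ha : (a : Site 3) ∈ box 3 n) (hb : (b : Site 3) ∈ box 3 n)
    (p : Current (freeBoxGraph 3 n) × Current (freeBoxGraph 3 n)) :
    epairWeight (fun _ : (freeBoxGraph 3 n).edgeFinset => criticalBeta 3) ({o} ∆ {x}) ∅ p *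
        (ENNReal.ofReal (screenWeight n r o a b (sourcedTrace 3 n p) / screenWeight n n o a b (sourcedTrace 3 n p)) *
          Current.offRatio (fun _ : (freeBoxGraph 3 n).edgeFinset => criticalBeta 3)
            ((p.1 + p.2).cluster o) ({a} ∆ {b})) *
        (ecurrentSum (fun _ : (freeBoxGraph 3 n).edgeFinset => criticalBeta 3) ({o} ∆ {x}) *
          ecurrentSum (fun _ : (freeBoxGraph 3 n).edgeFinset => criticalBeta 3) ({a} ∆ {b}))⁻¹ =
      epairWeight (fun _ : (freeBoxGraph 3 n).edgeFinset => criticalBeta 3) ({o} ∆ {x}) ∅ p *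
        (ecurrentSum (fun _ : (freeBoxGraph 3 n).edgeFinset => criticalBeta 3) ({o} ∆ {x}) *
          ecurrentSum (fun _ : (freeBoxGraph 3 n).edgeFinset => criticalBeta 3) ∅)⁻¹ *
        ENNReal.ofReal (if screenWeight n n o a b (sourcedTrace 3 n p) = 0 then 0
          else screenWeight n r o a b (sourcedTrace 3 n p)) := by
  set K : (freeBoxGraph 3 n).edgeFinset → ℝ := fun _ => criticalBeta 3 with hKc
  have hβ : 0 ≤ criticalBeta 3 := criticalBeta_nonneg 3
  have hK : ∀ e : (freeBoxGraph 3 n).edgeFinset, 0 ≤ K e := fun _ => hβ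
  have hcA := currentSum_pair_ne_zero n ho hx
  have hcB := currentSum_pair_ne_zero n ha hb
  have hc0 : currentSum (freeBoxGraph 3 n) (criticalBeta 3) ∅ ≠ 0 := (currentSum_empty_pos' _ _).ne'
  have hZtop : ∀ S : Finset (BoxVertex 3 n), ecurrentSum K S ≠ ∞ := fun S => ecurrentSum_ne_top hK S
  have hZne : ∀ S : Finset (BoxVertex 3 n), currentSum (freeBoxGraph 3 n) (criticalBeta 3) S ≠ 0 →
      ecurrentSum K S ≠ 0 := fun S hS h =>
    hS (by rw [currentSum_eq_wcurrentSum, ← hKc, ← toReal_ecurrentSum hK, h, ENNReal.toReal_zero])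
  have hsw0 : ∀ (r' : ℕ) (ω : BondConfig (Site 3)), 0 ≤ screenWeight n r' o a b ω := fun r' ω =>
    floorsRed_screenWeight_nonneg ha hb ω
  by_cases hsn : screenWeight n n o a b (sourcedTrace 3 n p) = 0
  · rw [hsn, if_pos rfl, div_zero, ENNReal.ofReal_zero, zero_mul, mul_zero, zero_mul, mul_zero]
  · rw [if_neg hsn]
    have hind := twoStrand_not_mem_cluster p hsn
    have hfull := screenWeight_sourcedTrace n ho ha hb p
    rw [if_neg hind, one_mul, ← hKc] at hfull
    have hq0 : Current.offRatio K ((p.1 + p.2).cluster o) ({a} ∆ {b}) ≠ 0 := fun h0 =>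
      hsn (by rw [hfull, h0, zero_mul, ENNReal.zero_div, ENNReal.toReal_zero])
    have hne : Current.offRatio K ((p.1 + p.2).cluster o) ({a} ∆ {b}) * ecurrentSum K ∅ / ecurrentSum K ({a} ∆ {b}) ≠
        ∞ := ENNReal.div_ne_top (ENNReal.mul_ne_top (offRatio_ne_top hK _ _) (hZtop _)) (hZne _ hcB)
    have hofReal : ENNReal.ofReal (screenWeight n n o a b (sourcedTrace 3 n p)) =
        Current.offRatio K ((p.1 + p.2).cluster o) ({a} ∆ {b}) * ecurrentSum K ∅ / ecurrentSum K ({a} ∆ {b}) := by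
      rw [hfull, ENNReal.ofReal_toReal hne]
    have hpos : 0 < screenWeight n n o a b (sourcedTrace 3 n p) := lt_of_le_of_ne (hsw0 n _) (Ne.symm hsn)
    exact twoStrand_algebra (epairWeight_ne_top _ _ _ p) hq0 (offRatio_ne_top hK _ _) (hZne _ hcA)
      (hZtop _) (hZne _ hcB) (hZtop _) (hZne _ hc0) (hZtop _) (hsw0 r _) hofReal hpos

/-- **THE TWO-STRAND FORM OF THE SCREENING LADDER** (box vertices): for `o, x, a, b ∈ Λ_n` and every `r`,
`meanScreening n r o x a b = ∫ sw_r/sw_n dP^{{o}∆{x},{a}∆{b}}_{Λ_n} + ∫ 𝟙{sw_n = 0}·sw_r dP^{{o}∆{x},∅}_{Λ_n}`.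
[cite: AizenmanDuminilCopinAnnals2021, Appendix A, Lemma A.1] -/
theorem meanScreening_twoStrand_box (n r : ℕ) (o x a b : BoxVertex 3 n) (ho : (o : Site 3) ∈ box 3 n)
    (hx : (x : Site 3) ∈ box 3 n) (ha : (a : Site 3) ∈ box 3 n) (hb : (b : Site 3) ∈ box 3 n) :
    meanScreening n r o x a b =
      (∫ ω, screenWeight n r o a b ω / screenWeight n n o a b ω
        ∂(sourcedDoubleCurrentLaw 3 n (criticalBeta 3) ({(o : Site 3)} ∆ {(x : Site 3)})
          ({(a : Site 3)} ∆ {(b : Site 3)}))) +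
      ∫ ω, (if screenWeight n n o a b ω = 0 then screenWeight n r o a b ω else 0)
        ∂(sourcedDoubleCurrentLaw 3 n (criticalBeta 3) ({(o : Site 3)} ∆ {(x : Site 3)}) ∅) := by
  set K : (freeBoxGraph 3 n).edgeFinset → ℝ := fun _ => criticalBeta 3 with hKc
  -- nondegeneracy of the normalisers (as in `meanScreening_eq_one_sub`)
  have hβ : 0 ≤ criticalBeta 3 := criticalBeta_nonneg 3
  have hK : ∀ e : (freeBoxGraph 3 n).edgeFinset, 0 ≤ K e := fun _ => hβ
  have hsA : boxSources 3 n (({(o : Site 3)} : Finset (Site 3)) ∆ {(x : Site 3)}) = {o} ∆ {x} := boxSources_pair 3 n o x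
  have hsB : boxSources 3 n (({(a : Site 3)} : Finset (Site 3)) ∆ {(b : Site 3)}) = {a} ∆ {b} := boxSources_pair 3 n a b
  have hs0 : boxSources 3 n (∅ : Finset (Site 3)) = ∅ := boxSources_empty n
  have hcA := currentSum_pair_ne_zero n ho hx
  have hcB := currentSum_pair_ne_zero n ha hb
  have hc0 : currentSum (freeBoxGraph 3 n) (criticalBeta 3) ∅ ≠ 0 := (currentSum_empty_pos' _ _).ne'
  haveI hPA : IsProbabilityMeasure
      (sourcedDoubleCurrentLaw 3 n (criticalBeta 3) ({(o : Site 3)} ∆ {(x : Site 3)}) ∅) :=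
    isProbabilityMeasure_sourcedDoubleCurrentLaw hβ (by rw [hsA]; exact hcA) (by rw [hs0]; exact hc0)
  have hsw0 : ∀ (r' : ℕ) (ω : BondConfig (Site 3)), 0 ≤ screenWeight n r' o a b ω := fun r' ω =>
    floorsRed_screenWeight_nonneg ha hb ω
  -- Step 1: split the mean screening along `{sw_n = 0}`
  have hsplit : meanScreening n r o x a b =
      (∫ ω, (if screenWeight n n o a b ω = 0 then 0 else screenWeight n r o a b ω)
        ∂(sourcedDoubleCurrentLaw 3 n (criticalBeta 3) ({(o : Site 3)} ∆ {(x : Site 3)}) ∅)) +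
      ∫ ω, (if screenWeight n n o a b ω = 0 then screenWeight n r o a b ω else 0)
        ∂(sourcedDoubleCurrentLaw 3 n (criticalBeta 3) ({(o : Site 3)} ∆ {(x : Site 3)}) ∅) := by
    have hb1 : ∀ ω, |(if screenWeight n n o a b ω = 0 then 0 else screenWeight n r o a b ω)| ≤
        |boxTwoPoint n ∅ a b|⁻¹ := fun ω => by
      split_ifs
      · rw [abs_zero]; exact inv_nonneg.2 (abs_nonneg _)
      · exact floorsRed_abs_screenWeight_le n r o a b ω
    have hb2 : ∀ ω, |(if screenWeight n n o a b ω = 0 then screenWeight n r o a b ω else 0)| ≤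
        |boxTwoPoint n ∅ a b|⁻¹ := fun ω => by
      split_ifs
      · exact floorsRed_abs_screenWeight_le n r o a b ω
      · rw [abs_zero]; exact inv_nonneg.2 (abs_nonneg _)
    rw [← integral_add (floorsRed_integrable _ hb1) (floorsRed_integrable _ hb2)]
    refine integral_congr_ae (ae_of_all _ fun ω => ?_)
    show screenWeight n r o a b ω =
      (if screenWeight n n o a b ω = 0 then 0 else screenWeight n r o a b ω) +
        (if screenWeight n n o a b ω = 0 then screenWeight n r o a b ω else 0)
    split_ifs <;> simp
  -- Step 2: the functional `F = ofReal (sw_r/sw_n)` of Lemma A.1: local and vanishing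
  obtain ⟨F, hF⟩ : ∃ F : Current (freeBoxGraph 3 n) × Current (freeBoxGraph 3 n) → ℝ≥0∞, ∀ p, F p =
      ENNReal.ofReal (screenWeight n r o a b (sourcedTrace 3 n p) / screenWeight n n o a b (sourcedTrace 3 n p)) :=
    ⟨_, fun _ => rfl⟩
  have hloc : ∀ n₁ n₂ n₂' : Current (freeBoxGraph 3 n),
      (∀ e : (freeBoxGraph 3 n).edgeFinset,
        ¬ Current.EdgeOff ((n₁ + n₂).cluster o) (e : Sym2 (BoxVertex 3 n)) → n₂' e = n₂ e) →
      F (n₁, n₂') = F (n₁, n₂) := fun n₁ n₂ n₂' hag => by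
    rw [hF, hF, twoStrand_screenWeight_congr r a b hag, twoStrand_screenWeight_congr n a b hag]
  have hvan : ∀ n₁ n₂ : Current (freeBoxGraph 3 n), n₁.sources = {o} ∆ {x} →
      n₂.sources = {a} ∆ {b} → F (n₁, n₂) ≠ 0 → Disjoint ((n₁ + n₂).cluster o) ({a} ∆ {b}) := by
    intro n₁ n₂ _ _ hF0
    rw [hF] at hF0
    have hsn : screenWeight n n o a b (sourcedTrace 3 n (n₁, n₂)) ≠ 0 := fun h0 => by
      rw [h0, div_zero, ENNReal.ofReal_zero] at hF0
      exact hF0 rfl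
    have h := twoStrand_not_mem_cluster (n₁, n₂) hsn
    push Not at h
    exact Finset.disjoint_left.2 fun v hv hv' => by
      rcases Finset.mem_symmDiff.1 hv' with ⟨h', -⟩ | ⟨h', -⟩ <;> rw [Finset.mem_singleton.1 h'] at hv <;>
        [exact h.1 hv; exact h.2 hv]
  have hA1 := Current.tsum_epairWeight_eq_tsum_mul_offRatio hK o ({o} ∆ {x}) ({a} ∆ {b}) F hloc hvan
  -- Step 3: both integrals as `ℝ≥0∞` series; Lemma A.1 and the pointwise key
  have hf1 : ∀ ω : BondConfig (Site 3),
      (0 : ℝ) ≤ (if screenWeight n n o a b ω = 0 then 0 else screenWeight n r o a b ω) := fun ω => by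
    split_ifs
    · exact le_rfl
    · exact hsw0 r ω
  have hmain : (∫ ω, (if screenWeight n n o a b ω = 0 then 0 else screenWeight n r o a b ω)
        ∂(sourcedDoubleCurrentLaw 3 n (criticalBeta 3) ({(o : Site 3)} ∆ {(x : Site 3)}) ∅)) =
      ∫ ω, screenWeight n r o a b ω / screenWeight n n o a b ω
        ∂(sourcedDoubleCurrentLaw 3 n (criticalBeta 3) ({(o : Site 3)} ∆ {(x : Site 3)})
          ({(a : Site 3)} ∆ {(b : Site 3)})) := by
    rw [twoStrand_integral_eq_toReal_tsum n hsA hs0 hcA hc0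
        (fun ω => if screenWeight n n o a b ω = 0 then 0 else screenWeight n r o a b ω) hf1,
      twoStrand_integral_eq_toReal_tsum n hsA hsB hcA hcB
        (fun ω => screenWeight n r o a b ω / screenWeight n n o a b ω) fun ω => div_nonneg (hsw0 r ω) (hsw0 n ω)]
    refine congrArg ENNReal.toReal ?_
    show (∑' p : Current (freeBoxGraph 3 n) × Current (freeBoxGraph 3 n), epairWeight K ({o} ∆ {x}) ∅ p *
          (ecurrentSum K ({o} ∆ {x}) * ecurrentSum K ∅)⁻¹ *
          ENNReal.ofReal (if screenWeight n n o a b (sourcedTrace 3 n p) = 0 then 0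
            else screenWeight n r o a b (sourcedTrace 3 n p))) =
      ∑' p : Current (freeBoxGraph 3 n) × Current (freeBoxGraph 3 n), epairWeight K ({o} ∆ {x}) ({a} ∆ {b}) p *
          (ecurrentSum K ({o} ∆ {x}) * ecurrentSum K ({a} ∆ {b}))⁻¹ *
          ENNReal.ofReal (screenWeight n r o a b (sourcedTrace 3 n p) / screenWeight n n o a b (sourcedTrace 3 n p))
    calc (∑' p : Current (freeBoxGraph 3 n) × Current (freeBoxGraph 3 n), epairWeight K ({o} ∆ {x}) ∅ p *
            (ecurrentSum K ({o} ∆ {x}) * ecurrentSum K ∅)⁻¹ *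
            ENNReal.ofReal (if screenWeight n n o a b (sourcedTrace 3 n p) = 0 then 0
              else screenWeight n r o a b (sourcedTrace 3 n p)))
        = ∑' p : Current (freeBoxGraph 3 n) × Current (freeBoxGraph 3 n), epairWeight K ({o} ∆ {x}) ∅ p *
              (F p * Current.offRatio K ((p.1 + p.2).cluster o) ({a} ∆ {b})) * (ecurrentSum K ({o} ∆ {x}) *
                ecurrentSum K ({a} ∆ {b}))⁻¹ :=
          tsum_congr fun p => by rw [hF]; exact (twoStrand_key n r ho hx ha hb p).symm
      _ = (∑' p : Current (freeBoxGraph 3 n) × Current (freeBoxGraph 3 n), epairWeight K ({o} ∆ {x}) ∅ p *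
              (F p * Current.offRatio K ((p.1 + p.2).cluster o) ({a} ∆ {b}))) * (ecurrentSum K ({o} ∆ {x}) *
              ecurrentSum K ({a} ∆ {b}))⁻¹ :=
          ENNReal.tsum_mul_right
      _ = (∑' p : Current (freeBoxGraph 3 n) × Current (freeBoxGraph 3 n),
            epairWeight K ({o} ∆ {x}) ({a} ∆ {b}) p * F p) * (ecurrentSum K ({o} ∆ {x}) *
              ecurrentSum K ({a} ∆ {b}))⁻¹ := by
          rw [hA1]
      _ = ∑' p : Current (freeBoxGraph 3 n) × Current (freeBoxGraph 3 n),
            epairWeight K ({o} ∆ {x}) ({a} ∆ {b}) p * F p * (ecurrentSum K ({o} ∆ {x}) *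
                ecurrentSum K ({a} ∆ {b}))⁻¹ :=
          ENNReal.tsum_mul_right.symm
      _ = _ := tsum_congr fun p => by rw [hF]; ring
  rw [hsplit, hmain]

/-! ### The registered form and the pinch ladder -/

/-- **THE TWO-STRAND FORM OF THE SCREENING LADDER** (registered helper of the open stub `stub_floors`): for
`o, x, a, b ∈ Λ_n` and every exploration radius `r`,
`meanScreening n r o x a b = ∫ sw_r/sw_n dP^{{o}∆{x},{a}∆{b}}_{Λ_n,β_c} + ∫ 𝟙{sw_n = 0}·sw_r dP^{{o}∆{x},∅}_{Λ_n,β_c}`,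
`sw_r = screenWeight n r o a b`: ADC21 Lemma A.1 for `F = 𝟙[a,b ∉ C]·S_{ab}(C_r)/S_{ab}(C)`. Under the two-strand
law the first integrand is `𝟙{o ↮ a}·S_{ab}(C_r(o))/S_{ab}(C(o))` (the second current joins `a` to `b`, and
`sw_n > 0` iff `o ↮ a`); the second integral is the sealed-pocket mass, `0` at `r = n`.
[cite: AizenmanDuminilCopinAnnals2021, Appendix A, Lemma A.1] -/
theorem meanScreening_twoStrand : ∀ (n r : ℕ) (o x a b : Site 3), o ∈ box 3 n → x ∈ box 3 n → a ∈ box 3 n → b ∈ box 3 n → meanScreening n r o x a b = (∫ ω, screenWeight n r o a b ω / screenWeight n n o a b ω ∂(sourcedDoubleCurrentLaw 3 n (criticalBeta 3) ({o} ∆ {x}) ({a} ∆ {b}))) + ∫ ω, (if screenWeight n n o a b ω = 0 then screenWeight n r o a b ω else 0) ∂(sourcedDoubleCurrentLaw 3 n (criticalBeta 3) ({o} ∆ {x}) ∅) := by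
  intro n r o x a b ho hx ha hb
  exact meanScreening_twoStrand_box n r ⟨o, box_subset_box_succ 3 n ho⟩ ⟨x, box_subset_box_succ 3 n hx⟩
    ⟨a, box_subset_box_succ 3 n ha⟩ ⟨b, box_subset_box_succ 3 n hb⟩ ho hx ha hb

/-- **The one-pinch ladder in two-strand form**: for `2m + 1 ≤ n` and every `r`,
`pinchScreen n r m = ∫ sw_r/sw_n dP^{{0}∆{up m},{e₂}∆{dn m}}_{Λ_n} + ∫ 𝟙{sw_n = 0}·sw_r dP^{{0}∆{up m},∅}_{Λ_n}`,
`sw_r = screenWeight n r 0 e₂ (dn m)`. [cite: AizenmanDuminilCopinAnnals2021, Appendix A, Lemma A.1] -/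
theorem pinchScreen_twoStrand {n r m : ℕ} (hn : 2 * m + 1 ≤ n) :
    pinchScreen n r m =
      (∫ ω, screenWeight n r 0 e₂ (dn m) ω / screenWeight n n 0 e₂ (dn m) ω
        ∂(sourcedDoubleCurrentLaw 3 n (criticalBeta 3) ({0} ∆ {up m}) ({e₂} ∆ {dn m}))) +
      ∫ ω, (if screenWeight n n 0 e₂ (dn m) ω = 0 then screenWeight n r 0 e₂ (dn m) ω else 0)
        ∂(sourcedDoubleCurrentLaw 3 n (criticalBeta 3) ({0} ∆ {up m}) ∅) := by
  obtain ⟨hup, he₂, hdn⟩ := floorsRed_mem_box hn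
  exact meanScreening_twoStrand n r 0 (up m) e₂ (dn m) (zero_mem_box 3 n) hup he₂ hdn

end Summit.CriticalPhenomena.Ising3DConformalLimit.EnergyNotSigmaSquaredGapForcesFarMerging

end
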